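import Summits.ResolutionOfSingularities.ResolutionOfSingularities.Theorems.MarkedTransferCampaignW46ThreefoldsGammaFreeGlobalPowers
import Literature.AlgebraicGeometry.Resolution.MarkedResolutions
import Literature.AlgebraicGeometry.Resolution.RegularBlowup
import Literature.AlgebraicGeometry.Resolution.RegularSubschemeLocallyIrreducible
import HarnessLib

/-!
# [OURS · L1 W4.6 rung (ii)] POWER HOMOGENEITY OF THE HOST SHAPE — BGMW multiple blow-ups / marked resolutions of
# `(X, I, E, m)` and of `(X, I^k, E, k·m)` COINCIDE; stmt-16156's conclusion for `(I, E, m)` ↔ for `(I^k, E, k·m)`, PROVED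

Cell res-hironaka, LADDER-RESOLUTION rung L (D-0089), slot W4.6, rung (ii) (threefold hypersurfaces); seat res-L1-s46-pv-3
(gen 3). Host route MarkedTransfer, host item `HypersurfaceOrderReductionDimLeThree` (stmt-ResolutionOfSingularities-16156:
`∃ X′ Φ M′, IsMarkedResolution ⟨I, E, m⟩ Φ M′` for threefold hypersurface inputs); filed `--kind proof --supports` it
`--as helper`. Everything here is OURS: kernel theorems over PROVED tree lemmas; NOTHING is a statement of Hironaka's
manuscript; no typed `Hironaka2017` candidate enters; no named FACT is a hypothesis. AI-written; AI review is weaker than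
expert review. Companion of `…ThreefoldsGammaFreeGlobalPowers.lean` (p504621, the Γ-free shape).

## What is proved (no new definitions)

On a regular locally Noetherian scheme `X`, for `k ≥ 1` (BGMW Example 3.4.2 «`(𝓘^e, eμ)` is equivalent to `(𝓘, μ)`»,
promoted from supports to whole multiple blow-ups WITH boundary):

* `CampaignW46.IsMultipleBlowup.pow_marked` — a BGMW multiple blow-up of `(X, I, E, m)` with final marked ideal
  `(Z, J, E′, m)` IS a multiple blow-up of `(X, I^k, E, k·m)` with final marked ideal `(Z, J^k, E′, k·m)`: same centres
  (the supports agree at regular points, tree `le_idealOrder_pow_iff`; the boundary and its simple-normal-crossings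
  bookkeeping are literally the same), and the controlled transform of a power is the power of the controlled transform
  (`controlledTransform_pow_eq`, p504621). Stages stay regular (tree `IsBlowup.isRegular_of_isRegular_subscheme`, Liu 8.1.19).
* `CampaignW46.IsMultipleBlowup.of_pow_marked` — conversely, every multiple blow-up of `(X, I^k, E, k·m)` is one of
  `(X, I, E, m)` whose final ideal `J` has `(final ideal) = J^k` (same boundary).
* `CampaignW46.exists_isMarkedResolution_pow_iff` — **`(∃ X′ Φ M′, IsMarkedResolution ⟨I^k, E, k·m⟩ Φ M′) ↔
  (∃ X′ Φ M′, IsMarkedResolution ⟨I, E, m⟩ Φ M′)`**: the host item's conclusion for a NON-REDUCED hypersurface `f^k`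
  with marking `k·m₀` and boundary `E` is equivalent to that for `(f, E, m₀)`.

HONEST VALUE. Structure, not a rung; the host-shape twin of p504621. It removes pure multiplicities from the open part of
rung (ii) in the host's own shape (markings divisible by the multiplicity only).

References: `…ThreefoldsGammaFreeGlobalPowers.lean` (p504621: `controlledTransform_pow_eq`, `le_idealOrder_pow_of_le`), tree
`Resolution/KollarStep2Stage.lean` (`le_idealOrder_pow_iff` [BierstoneGrigorievMilmanWlodarczyk2011, Example 3.4.2]),
`Resolution/MarkedIdeals.lean` (`IsMultipleBlowup`, `IsMarkedResolution`, `MarkedIdeal.transform` [BierstoneGrigorievMilmanWlodarczyk2011,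
Def. 3.1.3]), `Resolution/MarkedResolutions.lean` (`IsMultipleBlowup.isLocallyNoetherian`), `Resolution/RegularBlowup.lean`
(`IsBlowup.isRegular_of_isRegular_subscheme` [Liu2002, Thm. 8.1.19 (a)]), `Resolution/RegularSubschemeLocallyIrreducible.lean`
(`eq_vanishingIdeal_support_of_isRegular`). H. Hironaka, ms. 2017-03-23 — scope only, under adjudication, not cited as fact.
[Hironaka2017]
-/

noncomputable section

set_option linter.dupNamespace false -- mandated namespace of this single-conjunct summit

open CategoryTheory AlgebraicGeometry TopologicalSpace IsLocalRing

namespace Summit.ResolutionOfSingularities.ResolutionOfSingularities.Theorems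

namespace CampaignW46

open Literature.AlgebraicGeometry.Resolution
open Scheme.IdealSheafData

universe u

variable {X : Scheme.{u}} [IsLocallyNoetherian X]

/-! ## §1 One BGMW step: the transform of the powered marked ideal -/

/-- **All stages of a BGMW multiple blow-up of a regular locally Noetherian scheme are regular** (each centre is a
regular closed subscheme; Liu 8.1.19 (a), tree `IsBlowup.isRegular_of_isRegular_subscheme`; induction).
[cite: Liu2002, Thm. 8.1.19 (a)] -/
theorem IsMultipleBlowup.isRegular_stages (hX : Scheme.IsRegular X) {M : MarkedIdeal X} :
    ∀ {Z : Scheme.{u}} {σ : Z ⟶ X} {N : MarkedIdeal Z}, IsMultipleBlowup M σ N → Scheme.IsRegular Z := by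
  intro Z σ N h
  induction h with
  | refl => exact hX
  | blowup h C τ hτ hC hsupp hsnc ih =>
    haveI : IsLocallyNoetherian _ := h.isLocallyNoetherian
    exact IsBlowup.isRegular_of_isRegular_subscheme ih hC hτ

/-- **The BGMW transform of the powered marked ideal is the powered transform**: for a regular centre `V(C)` inside the
support of `(Z, J, E′, μ)` on a regular locally Noetherian `Z` and a blowing up `τ` along `C` (target locally
Noetherian), `(⟨J^k, E′, k·μ⟩.transform τ C) = ⟨(J-transform)^k, E′-transform, k·μ⟩` (the boundary bookkeeping does not
see the ideal; the ideal part is `controlledTransform_pow_eq`). [cite: BierstoneGrigorievMilmanWlodarczyk2011, Example 3.4.2] -/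
theorem MarkedIdeal.transform_pow_eq {Z Z' : Scheme.{u}} [IsLocallyNoetherian Z] [IsLocallyNoetherian Z']
    (hZ : Scheme.IsRegular Z) (N : MarkedIdeal Z) {C : Z.IdealSheafData} {τ : Z' ⟶ Z} (hτ : IsBlowup τ C)
    (hC : Scheme.IsRegular C.subscheme) (hsupp : (C.support : Set Z) ⊆ N.support) (k : ℕ) :
    (⟨N.ideal ^ k, N.boundary, k * N.mult⟩ : MarkedIdeal Z).transform τ C =
      ⟨(N.transform τ C).ideal ^ k, (N.transform τ C).boundary, k * N.mult⟩ := by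
  have hCeq : C = vanishingIdeal C.support := eq_vanishingIdeal_support_of_isRegular C hC
  have hreg : Scheme.IsRegular (vanishingIdeal C.support).subscheme := by rw [← hCeq]; exact hC
  have hτ' : IsBlowup τ (vanishingIdeal C.support) := by rw [← hCeq]; exact hτ
  have hD : ∀ y ∈ (C.support : Set Z), (N.mult : ℕ∞) ≤ idealOrder N.ideal y := fun y hy => hsupp hy
  have key := controlledTransform_pow_eq hZ hreg hτ' hD k
  rw [← hCeq] at key
  simp only [MarkedIdeal.transform, MarkedIdeal.mk.injEq, and_true]
  exact key

/-! ## §2 Whole multiple blow-ups -/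

/-- **POWERS, HOST SHAPE: a BGMW multiple blow-up of `(X, I, E, m)` is one of `(X, I^k, E, k·m)`**, with final marked
ideal `(Z, J^k, E′, k·m)` (regular locally Noetherian `X`; same stages, centres, boundaries).
[cite: BierstoneGrigorievMilmanWlodarczyk2011, Example 3.4.2] -/
theorem IsMultipleBlowup.pow_marked (hX : Scheme.IsRegular X) (k : ℕ) {M : MarkedIdeal X} :
    ∀ {Z : Scheme.{u}} {σ : Z ⟶ X} {N : MarkedIdeal Z}, IsMultipleBlowup M σ N →
      IsMultipleBlowup (⟨M.ideal ^ k, M.boundary, k * M.mult⟩ : MarkedIdeal X) σ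
        ⟨N.ideal ^ k, N.boundary, k * N.mult⟩ := by
  intro Z σ N h
  induction h with
  | refl => exact IsMultipleBlowup.refl _
  | @blowup Z₀ Z₁ σ₀ N₀ h₀ C τ hτ hC hsupp hsnc ih =>
    haveI : IsLocallyNoetherian Z₀ := h₀.isLocallyNoetherian
    haveI : IsLocallyNoetherian Z₁ := (h₀.blowup C τ hτ hC hsupp hsnc).isLocallyNoetherian
    have hR₀ : Scheme.IsRegular Z₀ := IsMultipleBlowup.isRegular_stages hX h₀
    have hsupp' : (C.support : Set Z₀) ⊆ (⟨N₀.ideal ^ k, N₀.boundary, k * N₀.mult⟩ : MarkedIdeal Z₀).support :=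
      fun y hy => le_idealOrder_pow_of_le N₀.ideal (hsupp hy) k
    have step := ih.blowup C τ hτ hC hsupp' hsnc
    rw [MarkedIdeal.transform_pow_eq hR₀ N₀ hτ hC hsupp k] at step
    have hmult : (N₀.transform τ C).mult = N₀.mult := rfl
    rw [hmult]
    exact step

/-- **CONVERSELY: a BGMW multiple blow-up of `(X, I^k, E, k·m)`, `k ≥ 1`, is one of `(X, I, E, m)`**, with the final
ideal of the former the `k`-th power of the final ideal of the latter and the same final boundary (regular locally
Noetherian `X`). [cite: BierstoneGrigorievMilmanWlodarczyk2011, Example 3.4.2] -/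
theorem IsMultipleBlowup.of_pow_marked (hX : Scheme.IsRegular X) {k : ℕ} (hk : 0 < k) {I : X.IdealSheafData}
    {E : List X.IdealSheafData} {m : ℕ} :
    ∀ {Z : Scheme.{u}} {σ : Z ⟶ X} {N' : MarkedIdeal Z},
      IsMultipleBlowup (⟨I ^ k, E, k * m⟩ : MarkedIdeal X) σ N' →
        ∃ N : MarkedIdeal Z, IsMultipleBlowup (⟨I, E, m⟩ : MarkedIdeal X) σ N ∧
          N' = ⟨N.ideal ^ k, N.boundary, k * N.mult⟩ := by
  intro Z σ N' h
  suffices H : ∀ {M' : MarkedIdeal X} {Z : Scheme.{u}} {σ : Z ⟶ X} {N' : MarkedIdeal Z},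
      IsMultipleBlowup M' σ N' → M' = ⟨I ^ k, E, k * m⟩ →
        ∃ N : MarkedIdeal Z, IsMultipleBlowup (⟨I, E, m⟩ : MarkedIdeal X) σ N ∧
          N' = ⟨N.ideal ^ k, N.boundary, k * N.mult⟩ from H h rfl
  intro M' Z σ N' h
  induction h with
  | refl =>
    rintro rfl
    exact ⟨⟨I, E, m⟩, IsMultipleBlowup.refl _, rfl⟩
  | @blowup Z₀ Z₁ σ₀ N₀ h₀ C τ hτ hC hsupp hsnc ih =>
    rintro rfl
    obtain ⟨N, hN, rfl⟩ := ih rfl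
    haveI : IsLocallyNoetherian Z₀ := hN.isLocallyNoetherian
    have hR₀ : Scheme.IsRegular Z₀ := IsMultipleBlowup.isRegular_stages hX hN
    -- at regular points `k·μ ≤ ord (J^k) ↔ μ ≤ ord J`
    have hsupp' : (C.support : Set Z₀) ⊆ N.support := by
      intro y hy
      haveI := hR₀ y
      exact (le_idealOrder_pow_iff N.ideal hk N.mult).mp (hsupp hy)
    haveI : IsLocallyNoetherian Z₁ := (hN.blowup C τ hτ hC hsupp' hsnc).isLocallyNoetherian
    refine ⟨N.transform τ C, hN.blowup C τ hτ hC hsupp' hsnc, ?_⟩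
    rw [MarkedIdeal.transform_pow_eq hR₀ N hτ hC hsupp' k]
    rfl

/-! ## §3 Marked resolutions; the host item's conclusion -/

/-- **POWER HOMOGENEITY OF THE HOST ITEM'S CONCLUSION**: on a regular locally Noetherian `X`, for `k ≥ 1`, the marked
ideal `(X, I^k, E, k·m)` has a BGMW marked resolution iff `(X, I, E, m)` has one (same resolving sequence; the final
supports agree at the regular points of the last stage). [cite: BierstoneGrigorievMilmanWlodarczyk2011, Example 3.4.2] -/
theorem exists_isMarkedResolution_pow_iff (hX : Scheme.IsRegular X) {I : X.IdealSheafData}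
    {E : List X.IdealSheafData} {m k : ℕ} (hk : 0 < k) :
    (∃ (X' : Scheme.{u}) (Φ : X' ⟶ X) (M' : MarkedIdeal X'), IsMarkedResolution (⟨I ^ k, E, k * m⟩ : MarkedIdeal X) Φ M') ↔
      ∃ (X' : Scheme.{u}) (Φ : X' ⟶ X) (M' : MarkedIdeal X'), IsMarkedResolution (⟨I, E, m⟩ : MarkedIdeal X) Φ M' := by
  constructor
  · rintro ⟨X', Φ, M', hmb, hsupp⟩
    obtain ⟨N, hN, rfl⟩ := IsMultipleBlowup.of_pow_marked hX hk hmb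
    have hR : Scheme.IsRegular X' := IsMultipleBlowup.isRegular_stages hX hN
    refine ⟨X', Φ, N, hN, ?_⟩
    ext y
    simp only [Set.mem_empty_iff_false, iff_false]
    intro hy
    haveI := hR y
    have hy' : y ∈ (⟨N.ideal ^ k, N.boundary, k * N.mult⟩ : MarkedIdeal X').support :=
      (le_idealOrder_pow_iff N.ideal hk N.mult).mpr hy
    rw [hsupp] at hy'
    exact hy'
  · rintro ⟨X', Φ, M', hmb, hsupp⟩
    have hR : Scheme.IsRegular X' := IsMultipleBlowup.isRegular_stages hX hmb
    refine ⟨X', Φ, ⟨M'.ideal ^ k, M'.boundary, k * M'.mult⟩, IsMultipleBlowup.pow_marked hX k hmb, ?_⟩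
    ext y
    simp only [Set.mem_empty_iff_false, iff_false]
    intro hy
    haveI := hR y
    have hy' : y ∈ M'.support := (le_idealOrder_pow_iff M'.ideal hk M'.mult).mp hy
    rw [hsupp] at hy'
    exact hy'

end CampaignW46

end Summit.ResolutionOfSingularities.ResolutionOfSingularities.Theorems

end
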